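import Literature.AnabelianGeometry.SemiGraphs.TemperedCurveHyperbolicWitness
import Literature.AnabelianGeometry.SemiGraphs.TemperedAnabelianWitness
import HarnessLib

/-!
# [SemiAnbd] Thm. 6.4 / 6.8 over the ORIGIN certificate: the universal closures are FALSE over
# abstract data (schema verdict for FACT-LIST rows F-1693, F-1681, F-1682; note on F-1686)

Mochizuki, *Semi-graphs of anabelioids*, Publ. RIMS **42** (2006) [SemiAnbd], Thm. 6.4 pp. 70–71 and
Thm. 6.8 pp. 74–75. [cite: MochizukiSemiAnbd2006, Thm 6.4 pp.70-71] [cite: MochizukiSemiAnbd2006, Thm 6.8 pp.74-75]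

PROOF-ONLY file (abc-iut cell, F-TRANCHES tranche 169, prover abc-iut-w5-d040; no definition).  The
statements file `TemperedAnabelianMorphisms.lean` (abc-iut-L3-t4) types Thm. 6.4 / 6.8 over ABSTRACT
interface data (`TemperedCurveHom`, `DLocContext`, `CurveArithmeticFlags`) and asserts them only for
data CERTIFIED by an origin `Ω : TemperedMorphismOrigin p` (`TemperedAnabelianTheoremHolds Ω`,
`DLocGroupTheoreticityHolds Ω`, `DecompositionPreservationHolds Ω`).  The frozen FACT-LIST lists these as
bindable rows; this file records the SCHEMA VERDICT: their universal closures (over all `Ω`, in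
particular the all-certifying one, and over all abstract data) are FALSE, so the certificate is
necessary and only INSTANCE forms at genuine data can be facts:

* F-1693 `TemperedAnabelianTheoremHolds`: `not_forall_temperedAnabelianTheoremHolds` — at the
  all-certifying `Ω` take the EMPTY dominant-morphism datum `C` on any `X = Y`; the identity of
  `Π^temp_{X_K}` is a Galois-compatible DOF homomorphism (`isGaloisCompatibleDOFHom_id`), so clause 2
  of `TemperedAnabelianTheorem C` ("every such `φ` comes from some `f`") fails
  (`not_temperedAnabelianTheorem_of_isEmpty`).
* F-1682 `DecompositionPreservationHolds`: `not_forall_decompositionPreservationHolds` — junk flags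
  (`IsDefinedOverNumberField := True` on `X`, `:= False` on `Y = X`) falsify `DefinedOverNumberFieldIff`.
* F-1681 `DLocGroupTheoreticityHolds`: `not_forall_dLocGroupTheoreticityHolds` — the interface
  `DLocContext` carries the category structure on `DLocObj X` as a FREE field `catG`; at the tree's
  non-degenerate toy `TemperedCurve.toyHyperbolic` (abc-iut-w5-d040 gen 2) there are TWO distinct objects
  of `DLoc_{G_K}(Π^temp)` (no cusp filled / the cusp filled, `DLocObj.exists_dLocObj_ne`), so a context
  with the DISCRETE category structure and the constant functor violates the conjunct `DLocEquivalence`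
  (Thm 6.8 (i)).
* F-1686 `IsoInducesDLocEquivalence` (a predicate of the data `(X, Y, DX, DY, α)`): NO universal-closure
  refutation is offered here (with the free field `catG` the identity equivalence transports `(H, N)`
  along `α = id` in any category structure); its INSTANCE forms are PROVED in the tree at the genuine
  category (`DLocObj.isoInducesDLocEquivalence_of_thm65iii`, abc-iut-L3-t4, from Thm 6.5 (iii)) and at
  the toy for `α = id` (`TemperedCurveHyperbolicWitness.lean`) — recorded, nothing added.
INSTANCE FORMS (not affected, cited by name): `DLocObj.isoInducesDLocEquivalence_of_thm65iii`
(abc-iut-L3-t4, p412957: Thm 6.8 (ii) equivalence clause at the GENUINE category from Thm 6.5 (iii)),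
the toy instances of `TemperedCurveHyperbolicWitness.lean` (α = id), `Thm68Sub.definedOverNumberFieldIff_of`
(p413929).  A refuted universal closure over ABSTRACT data says only that the origin certificate is
necessary; nothing of [SemiAnbd] is refuted or asserted; no side is taken on [IUTchIII] Cor. 3.12.
-/

noncomputable section

namespace Literature.AnabelianGeometry.SemiGraphs

open CategoryTheory
open scoped Pointwise

universe u

variable {p : ℕ} [Fact p.Prime]

namespace TemperedCurve

/-! ### F-1693: Thm. 6.4 over the origin -/

/-- The identity of `Π^temp_{X_K}` is a Galois-compatible DOF homomorphism (`U := Π^temp`, `g := 1`,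
`L = K ↪ K`). [cite: MochizukiSemiAnbd2006, Thm 6.4 pp.70-71] -/
theorem isGaloisCompatibleDOFHom_id (X : TemperedCurve p) :
    IsGaloisCompatibleDOFHom X X (ContinuousMonoidHom.id X.PiTemp) := by
  refine ⟨⟨⊤, ?_, inferInstance, ?_⟩, 1, ?_, fun x => by simp⟩
  · rw [Subgroup.coe_top]; exact isOpen_univ
  · have : ((ContinuousMonoidHom.id X.PiTemp).toMonoidHom.range : Subgroup X.PiTemp) = ⊤ :=
      MonoidHom.range_eq_top.mpr fun x => ⟨x, rfl⟩
    rw [this, Subgroup.coe_top, closure_univ]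
  · have h1 : ((1 : GQp p) : AlgebraicClosure ℚ_[p] →ₐ[ℚ_[p]] AlgebraicClosure ℚ_[p]) =
        AlgHom.id ℚ_[p] (AlgebraicClosure ℚ_[p]) := by
      ext x; rfl
    rw [h1, IntermediateField.map_id]

/-- Thm. 6.4 AS TYPED fails for a dominant-morphism datum with NO morphisms: clause 2 ("every
Galois-compatible DOF homomorphism comes from some dominant morphism") applied to the identity.
[cite: MochizukiSemiAnbd2006, Thm 6.4 pp.70-71] -/
theorem not_temperedAnabelianTheorem_of_isEmpty {X : TemperedCurve p} (C : TemperedCurveHom p X X)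
    [IsEmpty C.DomHom] : ¬ TemperedAnabelianTheorem C := by
  rintro ⟨-, h2, -⟩
  obtain ⟨f, -⟩ := h2 _ (isGaloisCompatibleDOFHom_id X)
  exact isEmptyElim f

end TemperedCurve

namespace TemperedMorphismOrigin

/-- **F-1693, schema verdict**: `TemperedAnabelianTheoremHolds` is FALSE at the all-certifying origin
(empty dominant-morphism datum on `X = Y := TemperedCurve.degenerate p`), hence not a universally valid
statement over abstract data — the certificate `IsDomHomOrigin` is necessary.
[cite: MochizukiSemiAnbd2006, Thm 6.4 pp.70-71] -/
theorem not_forall_temperedAnabelianTheoremHolds (p : ℕ) [Fact p.Prime] :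
    ¬ ∀ Ω : TemperedMorphismOrigin p, Ω.TemperedAnabelianTheoremHolds := by
  intro h
  let Ω : TemperedMorphismOrigin p :=
    { IsHyperbolicCurveOrigin := fun _ => True
      IsDomHomOrigin := fun _ => True
      IsDLocOrigin := fun _ => True
      IsFlagsOrigin := fun _ => True }
  let C : TemperedCurveHom p (TemperedCurve.degenerate p) (TemperedCurve.degenerate p) :=
    ⟨Empty, fun e => e.elim⟩
  haveI : IsEmpty C.DomHom := inferInstanceAs (IsEmpty Empty)
  exact TemperedCurve.not_temperedAnabelianTheorem_of_isEmpty C (h Ω _ _ C trivial trivial trivial)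

/-! ### F-1682: Thm. 6.8 (iii)(iv) / Cor. 6.9 over the origin -/

/-- **F-1682, schema verdict**: `DecompositionPreservationHolds` is FALSE at the all-certifying origin:
with uncertified ("junk") arithmetic flags — "defined over a number field" true for `X` and false for
`Y = X` — the conjunct `DefinedOverNumberFieldIff` fails.  The certificate `IsFlagsOrigin` is necessary;
instance forms (`Thm68Sub.definedOverNumberFieldIff_of`) are untouched.
[cite: MochizukiSemiAnbd2006, Thm 6.8(iv) p.75] -/
theorem not_forall_decompositionPreservationHolds (p : ℕ) [Fact p.Prime] :
    ¬ ∀ Ω : TemperedMorphismOrigin p, Ω.DecompositionPreservationHolds := by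
  intro h
  let Ω : TemperedMorphismOrigin p :=
    { IsHyperbolicCurveOrigin := fun _ => True
      IsDomHomOrigin := fun _ => True
      IsDLocOrigin := fun _ => True
      IsFlagsOrigin := fun _ => True }
  let X := TemperedCurve.degenerate p
  let aX : TemperedCurve.CurveArithmeticFlags X :=
    { IsOncePuncturedElliptic := True, IsTorsionPt := fun _ => True, IsIsogenousToGenusZero := True,
      IsAlgebraicPt := fun _ => True, IsDefinedOverNumberField := True }
  let aY : TemperedCurve.CurveArithmeticFlags X :=
    { IsOncePuncturedElliptic := True, IsTorsionPt := fun _ => True, IsIsogenousToGenusZero := True,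
      IsAlgebraicPt := fun _ => True, IsDefinedOverNumberField := False }
  have h1 := (h Ω X X aX aY trivial trivial trivial trivial).1 trivial trivial
    ⟨ContinuousMulEquiv.refl _⟩
  exact h1.mp trivial

end TemperedMorphismOrigin

/-! ### F-1681 / F-1686: Thm. 6.8 (i)(ii) over the origin — the free category field of `DLocContext` -/

namespace DLocObj

/-- **Two DISTINCT objects of `DLoc_{G_K}(Π^temp)` over the toy**: besides `DLocObj.toyHyperbolic`
(`H = ⊤`, no cusp filled in) there is the object with `H = ⊤` and the (unique) cusp filled in
(`gens = {I_x}`; its `J = Π^temp/N` is hyperbolic because `N ⊆ G_{ℚ_p} × Ẑ × 1` — the closed normal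
kernel of the projection to the `P`-factor contains `I_x = 1 × Ẑ × 1` — while `Δ^temp` has two elements
with non-trivial commutator in the `P`-factor). [cite: MochizukiSemiAnbd2006, §6 pp.73-74] -/
theorem exists_dLocObj_ne : ∃ B : DLocObj (TemperedCurve.toyHyperbolic p), B ≠ DLocObj.toyHyperbolic p := by
  haveI : IsGalois ℚ_[p] (AlgebraicClosure ℚ_[p]) := {}
  haveI : T2Space (GQp p) := krullTopology_t2
  let X := TemperedCurve.toyHyperbolic p
  let gens : Set (Subgroup X.PiTemp) := {X.inertia ()}
  let N : Subgroup X.PiTemp :=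
    ((Subgroup.normalClosure (⋃ I ∈ gens, ((I.subgroupOf ⊤ : Subgroup (⊤ : Subgroup X.PiTemp)) :
      Set (⊤ : Subgroup X.PiTemp)))).topologicalClosure).map (⊤ : Subgroup X.PiTemp).subtype
  -- the closed normal subgroup `K = G_{ℚ_p} × Ẑ × 1 = Ker(pr_P)` contains `N`
  let π : X.PiTemp →* Iw p := (MonoidHom.snd ZHat (Iw p)).comp (MonoidHom.snd (GQp p) (ZHat × Iw p))
  let K : Subgroup X.PiTemp := π.ker
  have hπc : Continuous π := by
    change Continuous fun x : ToyPi p => x.2.2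
    fun_prop
  have hNK : N ≤ K := by
    rw [Subgroup.map_le_iff_le_comap]
    have hKc : IsClosed (((K.comap (⊤ : Subgroup X.PiTemp).subtype : Subgroup (⊤ : Subgroup X.PiTemp)) :
        Set (⊤ : Subgroup X.PiTemp))) := by
      have hK' : IsClosed (K : Set X.PiTemp) := by
        have : (K : Set X.PiTemp) = π ⁻¹' {1} := by ext x; exact MonoidHom.mem_ker
        rw [this]; exact isClosed_singleton.preimage hπc
      exact hK'.preimage continuous_subtype_val
    haveI : (K.comap (⊤ : Subgroup X.PiTemp).subtype).Normal := Subgroup.Normal.comap inferInstance _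
    refine Subgroup.topologicalClosure_minimal _ (Subgroup.normalClosure_le_normal ?_) hKc
    intro z hz
    obtain ⟨I, hI, hzI⟩ := Set.mem_iUnion₂.mp hz
    have hI' : I = X.inertia () := Set.mem_singleton_iff.mp hI
    subst hI'
    have hz' : (z : X.PiTemp) ∈ X.inertia () := (Subgroup.mem_subgroupOf).mp hzI
    have hzD : ((z : X.PiTemp) : ToyPi p) ∈ toyDecomp p := (Subgroup.mem_inf.mp hz').1
    have hzD' : ((z : X.PiTemp) : ToyPi p).2.2 = 1 := (mem_toyDecomp_iff p _).1 hzD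
    exact hzD'
  refine ⟨{ H := ⊤
            isOpen_H := by rw [Subgroup.coe_top]; exact isOpen_univ
            finiteIndex_H := inferInstance
            gens := gens
            gens_cuspidal := fun I hI => ⟨X.inertia (),
              TemperedCurve.toyHyperbolic_isCuspidalGeometricDecompositionGroup p,
              by rw [Set.mem_singleton_iff.mp hI, top_inf_eq]⟩
            N := N
            N_eq := rfl
            hyperbolic := fun hall => ?_ }, fun hB => ?_⟩
  · -- two elements of `Δ^temp` with non-trivial commutator in the `P`-factor
    let a : ToyPi p := (1, (1, ⟨0, 1⟩))
    let b : ToyPi p := (1, (1, ⟨1, 0⟩))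
    have ha : (a : X.PiTemp) ∈ X.DeltaTemp ⊓ ⊤ :=
      ⟨(TemperedCurve.mem_toyHyperbolic_deltaTemp_iff p _).2 rfl, Subgroup.mem_top _⟩
    have hb : (b : X.PiTemp) ∈ X.DeltaTemp ⊓ ⊤ :=
      ⟨(TemperedCurve.mem_toyHyperbolic_deltaTemp_iff p _).2 rfl, Subgroup.mem_top _⟩
    have hmem : π (a * b * a⁻¹ * b⁻¹) = 1 := hNK (hall a ha b hb)
    have hc : (⟨0, 1⟩ : Iw p) * ⟨1, 0⟩ * (⟨0, 1⟩ : Iw p)⁻¹ * (⟨1, 0⟩ : Iw p)⁻¹ = 1 := hmem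
    rw [← commutatorElement_def, commutatorElement_eq_one_iff_mul_comm] at hc
    exact TemperedCurve.Iw_noncomm p hc
  · have h1 : gens = (DLocObj.toyHyperbolic p).gens := congrArg DLocObj.gens hB
    have h2 : (DLocObj.toyHyperbolic p).gens = ∅ := rfl
    rw [h2] at h1
    exact (Set.singleton_ne_empty _) h1

end DLocObj

namespace TemperedMorphismOrigin

/-- **F-1681, schema verdict**: `DLocGroupTheoreticityHolds` is FALSE at the all-certifying origin: the
interface `DLocContext` leaves the category structure `catG` on `DLocObj X` FREE, and at the toy, with
the DISCRETE structure and the constant "tempered fundamental group functor", the conjunct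
`DLocEquivalence` (Thm 6.8 (i)) fails — `DLocObj` has two distinct objects.  The certificate
`IsDLocOrigin` (the GENUINE `DLoc` data and category) is necessary; instance forms at the genuine
category (`DLocObj.isoInducesDLocEquivalence_of_thm65iii`, abc-iut-L3-t4) are untouched.
[cite: MochizukiSemiAnbd2006, Thm 6.8(i) p.74] -/
theorem not_forall_dLocGroupTheoreticityHolds (p : ℕ) [Fact p.Prime] :
    ¬ ∀ Ω : TemperedMorphismOrigin p, Ω.DLocGroupTheoreticityHolds := by
  intro h
  let Ω : TemperedMorphismOrigin p :=
    { IsHyperbolicCurveOrigin := fun _ => True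
      IsDomHomOrigin := fun _ => True
      IsDLocOrigin := fun _ => True
      IsFlagsOrigin := fun _ => True }
  let X := TemperedCurve.toyHyperbolic p
  -- the discrete category structure on `DLocObj X`
  let disc : Category.{0} (DLocObj X) :=
    { Hom := fun A B => PLift (A = B)
      id := fun A => ⟨rfl⟩
      comp := fun f g => ⟨f.down.trans g.down⟩ }
  let DX : DLocContext X :=
    { DLocK := ToyDLocK
      self := ToyDLocK.self
      curve := fun _ => X
      pi1 := fun _ => ContinuousMonoidHom.id _
      selfIso := ContinuousMulEquiv.refl _
      catG := disc
      pi1Functor := @Functor.const ToyDLocK _ (DLocObj X) disc |>.obj (DLocObj.toyHyperbolic p) }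
  have hE : X.DLocEquivalence DX := (h Ω X X DX DX trivial trivial trivial trivial).1
  -- the constant functor to a discrete category with two objects is not essentially surjective
  obtain ⟨B, hB⟩ := DLocObj.exists_dLocObj_ne (p := p)
  letI := DX.catG
  haveI : DX.pi1Functor.IsEquivalence := hE
  have i := DX.pi1Functor.objObjPreimageIso B
  have : (DLocObj.toyHyperbolic p) = B := (i.hom : PLift _).down
  exact hB this.symm

end TemperedMorphismOrigin



end Literature.AnabelianGeometry.SemiGraphs

end
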